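import Literature.NumberTheory.LFunctions.KloostermanFractionsFromC1
import Literature.NumberTheory.LFunctions.KloostermanFractionsC1
import Literature.NumberTheory.LFunctions.KloostermanFractionsWeilBound
import HarnessLib

/-!
# Trilinear forms with Kloosterman fractions: the Weil range `M ≫ N²` (Bettin–Chandee §6)

Topic `NumberTheory/LFunctions`.  S. Bettin, V. Chandee, *Trilinear forms with Kloosterman
fractions*, Adv. Math. 328 (2018), §6: "if `M ≫ N²` then one can obtain a stronger bound from
Theorem 5 of [DFI97], which gives `𝓒₁ ≪ ‖β‖²‖ν‖² A M^{1+ε}` in such range."  For the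
general-`A`, TWISTED second moment
`𝓒₁^{tw}(M,N,A) = ∑_{M<m≤2M} |∑_a ∑_{n,(m,n)=1} β_n ν_a e(ϑ a m̄/n + η a/(mn))|²` of
`TrilinearKloostermanFractionsFromC1.lean` (the object whose (6.4)-type bound implies the named
fact `BettinChandee2018_trilinearKloostermanFractions`, see
`BettinChandee2018_trilinearKloostermanFractions_of_C1A_bound`), this file PROVES that input from
the tree's Duke–Friedlander–Iwaniec material (`KloostermanFractionsWeilBound.lean`: Theorem 5 /
Theorem 1 with Weil's bound; `DeterminantEquationDFIProofs.lean`/`KloostermanFractionsUntwist.lean`: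
removal of a twist `e(X/mn)` by box splitting):

* `BC_dual_second_moment_le` — duality: a bilinear bound `‖∑_m α_m S_m‖ ≤ Q‖α‖` for all `α` on
  `(M,2M]` gives `∑_{M<m≤2M} |S_m|² ≤ Q²`;
* `BC_twisted_second_moment_weil` — single numerator, twisted:
  `∑_{M<m≤2M} |∑_{(m,n)=1} β_n e(k m̄/n + X/(mn))|² ≤ K τ(|k|) N^ε (1+|X|/(MN)) (M+N²) ‖β‖²`;
* **`BC_C1Atw_weil_range`** — `𝓒₁^{tw}(M,N,A) ≤ K ‖β‖²‖ν‖² ((1+|ϑ|+|η|)AMN)^ε (1+(|ϑ|+|η|)A/(MN)) A(M+N²)`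
  (Cauchy–Schwarz in `a`; for `M ≥ 4N²` this is the source's `A M^{1+ε}`).

No new named facts (D-0026).

## References

* S. Bettin, V. Chandee, *Trilinear forms with Kloosterman fractions*, Adv. Math. 328 (2018)
  1234–1262, arXiv:1502.00769, §6. [BettinChandee2018]
* W. Duke, J. Friedlander, H. Iwaniec, *Bilinear forms with Kloosterman fractions*, Invent. Math.
  128 (1997) 23–43, Theorems 1 and 5. [DukeFriedlanderIwaniec1997]
-/

noncomputable section

open Finset Real

namespace Literature.NumberTheory.LFunctions

/-- **Duality for second moments over `m ∼ M`.**  If `‖∑_{m ≤ 2M} α_m S_m‖ ≤ Q ‖α‖` for every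
`α` supported on `(M, 2M]`, then `∑_{M<m≤2M} |S_m|² ≤ Q²` (take `α_m = S̄_m 1_{(M,2M]}(m)`).
[folklore] -/
theorem BC_dual_second_moment_le {M Q : ℝ} (S : ℕ → ℂ)
    (hB : ∀ α : ℕ → ℂ, (∀ m : ℕ, α m ≠ 0 → M < m ∧ (m : ℝ) ≤ 2 * M) →
      ‖∑ m ∈ Icc 1 ⌊2 * M⌋₊, α m * S m‖ ≤
        Q * Real.sqrt (∑ m ∈ Icc 1 ⌊2 * M⌋₊, ‖α m‖ ^ 2)) :
    ∑ m ∈ Ioc ⌊M⌋₊ ⌊2 * M⌋₊, ‖S m‖ ^ 2 ≤ Q ^ 2 := by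
  classical
  set T : ℝ := ∑ m ∈ Ioc ⌊M⌋₊ ⌊2 * M⌋₊, ‖S m‖ ^ 2 with hT
  have hT0 : 0 ≤ T := Finset.sum_nonneg fun _ _ => sq_nonneg _
  set α : ℕ → ℂ := fun m => if m ∈ Ioc ⌊M⌋₊ ⌊2 * M⌋₊ then (starRingEnd ℂ) (S m) else 0 with hα
  have hsub : Ioc ⌊M⌋₊ ⌊2 * M⌋₊ ⊆ Icc 1 ⌊2 * M⌋₊ := by
    intro m hm
    rw [Finset.mem_Ioc] at hm
    exact Finset.mem_Icc.mpr ⟨by omega, hm.2⟩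
  have hsupp : ∀ m : ℕ, α m ≠ 0 → M < m ∧ (m : ℝ) ≤ 2 * M := by
    intro m hm
    have hmem : m ∈ Ioc ⌊M⌋₊ ⌊2 * M⌋₊ := by
      by_contra h
      apply hm
      show (if m ∈ Ioc ⌊M⌋₊ ⌊2 * M⌋₊ then (starRingEnd ℂ) (S m) else 0) = 0
      rw [if_neg h]
    rw [Finset.mem_Ioc] at hmem
    refine ⟨Nat.lt_of_floor_lt hmem.1, ?_⟩
    have h2M : (1 : ℝ) ≤ 2 * M := Nat.floor_pos.mp (by omega)
    exact le_trans (by exact_mod_cast hmem.2) (Nat.floor_le (by linarith))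
  -- the bilinear expression at this `α` is `T`, and `‖α‖ = √T`
  have hval : ∑ m ∈ Icc 1 ⌊2 * M⌋₊, α m * S m = (T : ℂ) := by
    have h1 : ∑ m ∈ Icc 1 ⌊2 * M⌋₊, α m * S m = ∑ m ∈ Ioc ⌊M⌋₊ ⌊2 * M⌋₊, α m * S m := by
      refine (Finset.sum_subset hsub fun m _ hm => ?_).symm
      show (if m ∈ Ioc ⌊M⌋₊ ⌊2 * M⌋₊ then (starRingEnd ℂ) (S m) else 0) * S m = 0
      rw [if_neg hm, zero_mul]
    rw [h1, hT]
    push_cast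
    refine Finset.sum_congr rfl fun m hm => ?_
    show (if m ∈ Ioc ⌊M⌋₊ ⌊2 * M⌋₊ then (starRingEnd ℂ) (S m) else 0) * S m = _
    rw [if_pos hm, Complex.conj_mul']
  have hnorm : ∑ m ∈ Icc 1 ⌊2 * M⌋₊, ‖α m‖ ^ 2 = T := by
    have h1 : ∑ m ∈ Icc 1 ⌊2 * M⌋₊, ‖α m‖ ^ 2 = ∑ m ∈ Ioc ⌊M⌋₊ ⌊2 * M⌋₊, ‖α m‖ ^ 2 := by
      refine (Finset.sum_subset hsub fun m _ hm => ?_).symm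
      show ‖(if m ∈ Ioc ⌊M⌋₊ ⌊2 * M⌋₊ then (starRingEnd ℂ) (S m) else 0)‖ ^ 2 = 0
      rw [if_neg hm]; simp
    rw [h1, hT]
    refine Finset.sum_congr rfl fun m hm => ?_
    show ‖(if m ∈ Ioc ⌊M⌋₊ ⌊2 * M⌋₊ then (starRingEnd ℂ) (S m) else 0)‖ ^ 2 = _
    rw [if_pos hm, Complex.norm_conj]
  have h := hB α hsupp
  rw [hval, hnorm, Complex.norm_real, Real.norm_eq_abs, abs_of_nonneg hT0] at h
  -- `T ≤ Q √T` ⟹ `T ≤ Q²`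
  have hsq : Real.sqrt T * Real.sqrt T = T := Real.mul_self_sqrt hT0
  have hs0 : 0 ≤ Real.sqrt T := Real.sqrt_nonneg _
  nlinarith [hsq, hs0, h, sq_nonneg (Real.sqrt T - Q)]

/-- The trilinear phase in the single-numerator notation of the tree's bilinear files
(numerator `k = ϑa`, twist `X = ηa`). [folklore] -/
theorem BC_triPhase_eq_DFI (ϑ : ℤ) (η : ℝ) (a m n u : ℕ) :
    Complex.exp (2 * Real.pi * Complex.I *
        ((ϑ : ℂ) * (a : ℂ) * (u : ℂ) / (n : ℂ) + (η : ℂ) * (a : ℂ) / ((m : ℂ) * (n : ℂ)))) =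
      Complex.exp (2 * Real.pi * Complex.I *
        (((ϑ * a : ℤ) : ℂ) * (u : ℂ) / (n : ℂ) + ((η * a : ℝ) : ℂ) / ((m : ℂ) * n))) := by
  congr 1; push_cast; ring

/-- **The Weil range for twisted bilinear second moments** (Duke–Friedlander–Iwaniec's
Theorem 5 made twisted): for every `ε > 0` there is `K` with, for `M, N ≥ 1/2`, `k ≠ 0`, real `X`
and `β` on `(N, 2N]`,
`∑_{M<m≤2M} |∑_{n,(m,n)=1} β_n e(k m̄/n + X/(mn))|² ≤ K τ(|k|) N^ε (1 + |X|/(MN)) (M + N²) ‖β‖²`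
(duality `BC_dual_second_moment_le`; the tree's `DFI_bilinear_weil_bound` — Theorem 1 of
Duke–Friedlander–Iwaniec with Weil's bound, all `β` at the cost `τ(|k|)^{1/2}` — made twisted by
`DFI_twisted_le_of_untwisted` at the cost `2e^{2π}(1 + |X|/(MN))^{1/2}`).
[cite: DukeFriedlanderIwaniec1997, Theorems 1 and 5] -/
theorem BC_twisted_second_moment_weil {ε : ℝ} (hε : 0 < ε) :
    ∃ K : ℝ, 0 < K ∧ ∀ (M N : ℝ), 1 / 2 ≤ M → 1 / 2 ≤ N → ∀ (k : ℤ), k ≠ 0 → ∀ (X : ℝ)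
      (β : ℕ → ℂ), (∀ n : ℕ, β n ≠ 0 → N < n ∧ (n : ℝ) ≤ 2 * N) →
      ∑ m ∈ Ioc ⌊M⌋₊ ⌊2 * M⌋₊, ‖∑ n ∈ Icc 1 ⌊2 * N⌋₊,
          (if m.Coprime n then
            β n * Complex.exp (2 * Real.pi * Complex.I *
              ((k : ℂ) * ((((m : ZMod n)⁻¹).val : ℕ) : ℂ) / (n : ℂ) + (X : ℂ) / ((m : ℂ) * n)))
          else 0)‖ ^ 2 ≤
        K * (k.natAbs.divisors.card : ℝ) * N ^ ε * (1 + |X| / (M * N)) * (M + N ^ 2) *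
          ∑ n ∈ Icc 1 ⌊2 * N⌋₊, ‖β n‖ ^ 2 := by
  obtain ⟨C, hC0, hC⟩ := DFI_bilinear_weil_bound (ε := ε / 2) (by positivity)
  refine ⟨8 * Real.exp (4 * Real.pi) * C ^ 2, by positivity, ?_⟩
  intro M N hM hN k hk X β hβ
  have hM0 : 0 < M := by linarith
  have hN0 : 0 < N := by linarith
  set nβ2 : ℝ := ∑ n ∈ Icc 1 ⌊2 * N⌋₊, ‖β n‖ ^ 2 with hnβ2
  have hnβ0 : 0 ≤ nβ2 := Finset.sum_nonneg fun _ _ => sq_nonneg _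
  set τ : ℝ := (k.natAbs.divisors.card : ℝ) with hτdef
  have hτ0 : 0 ≤ τ := Nat.cast_nonneg _
  set S : ℕ → ℂ := fun m => ∑ n ∈ Icc 1 ⌊2 * N⌋₊,
    (if m.Coprime n then
      β n * Complex.exp (2 * Real.pi * Complex.I *
        ((k : ℂ) * ((((m : ZMod n)⁻¹).val : ℕ) : ℂ) / (n : ℂ) + (X : ℂ) / ((m : ℂ) * n)))
    else 0) with hS
  -- the untwisted bound (Duke–Friedlander–Iwaniec with Weil), in the shape `K ‖α‖‖β‖ P₁ P₂`
  set Ka : ℝ := C * Real.sqrt τ * N ^ (ε / 2) with hKa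
  have hKa0 : 0 ≤ Ka := by positivity
  have hBu : ∀ (α' β' : ℕ → ℂ),
      (∀ m : ℕ, α' m ≠ 0 → M < m ∧ (m : ℝ) ≤ 2 * M) →
      (∀ n : ℕ, β' n ≠ 0 → N < n ∧ (n : ℝ) ≤ 2 * N) →
      ‖∑ m ∈ Finset.Icc 1 ⌊2 * M⌋₊, ∑ n ∈ Finset.Icc 1 ⌊2 * N⌋₊,
          if Nat.Coprime m n then
            α' m * β' n * Complex.exp (2 * Real.pi * Complex.I *
              ((k : ℂ) * ((((m : ZMod n)⁻¹).val : ℕ) : ℂ) / (n : ℂ)))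
          else 0‖ ≤
        Ka * Real.sqrt (∑ m ∈ Finset.Icc 1 ⌊2 * M⌋₊, ‖α' m‖ ^ 2) *
          Real.sqrt (∑ n ∈ Finset.Icc 1 ⌊2 * N⌋₊, ‖β' n‖ ^ 2) * (Real.sqrt M + N) * 1 := by
    intro α' β' hα' hβ'
    have h := hC M N hM hN k hk α' β' hα' hβ'
    calc _ ≤ _ := h
      _ = _ := by rw [hKa]; ring
  have hP0 : (0 : ℝ) ≤ Real.sqrt M + N := by positivity
  -- the twisted bound for `α` on `(M, 2M]`, then duality
  have hQ : ∀ α : ℕ → ℂ, (∀ m : ℕ, α m ≠ 0 → M < m ∧ (m : ℝ) ≤ 2 * M) →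
      ‖∑ m ∈ Icc 1 ⌊2 * M⌋₊, α m * S m‖ ≤
        (2 * Real.exp (2 * Real.pi) * Ka * (1 + |X| / (M * N)) ^ (1 / 2 : ℝ) *
          (Real.sqrt M + N) * Real.sqrt nβ2) *
          Real.sqrt (∑ m ∈ Icc 1 ⌊2 * M⌋₊, ‖α m‖ ^ 2) := by
    intro α hα
    have h := DFI_twisted_le_of_untwisted hM hN (k := k) hKa0 hP0 zero_le_one hBu X α β hα hβ
    have heq : ∑ m ∈ Icc 1 ⌊2 * M⌋₊, α m * S m =
        ∑ m ∈ Finset.Icc 1 ⌊2 * M⌋₊, ∑ n ∈ Finset.Icc 1 ⌊2 * N⌋₊,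
          if Nat.Coprime m n then
            α m * β n * Complex.exp (2 * Real.pi * Complex.I *
              ((k : ℂ) * ((((m : ZMod n)⁻¹).val : ℕ) : ℂ) / (n : ℂ) + (X : ℂ) / ((m : ℂ) * n)))
          else 0 := by
      refine Finset.sum_congr rfl fun m _ => ?_
      rw [hS]; dsimp only
      rw [Finset.mul_sum]
      refine Finset.sum_congr rfl fun n _ => ?_
      split_ifs
      · ring
      · rw [mul_zero]
    rw [heq]
    calc _ ≤ _ := h
      _ = _ := by rw [hnβ2]; ring
  have hT := BC_dual_second_moment_le S hQ
  clear hQ hBu hC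
  refine hT.trans ?_
  -- square out the constant
  have hP : (Real.sqrt M + N) ^ 2 ≤ 2 * (M + N ^ 2) := by
    have h := sq_nonneg (Real.sqrt M - N)
    rw [sub_sq, Real.sq_sqrt hM0.le] at h
    rw [add_sq, Real.sq_sqrt hM0.le]
    linarith
  have hW0 : 0 ≤ 1 + |X| / (M * N) := by positivity
  have hsqW : ((1 + |X| / (M * N)) ^ (1 / 2 : ℝ)) ^ 2 = 1 + |X| / (M * N) := by
    rw [← Real.rpow_two, ← Real.rpow_mul hW0]; norm_num
  have hsqτ : Real.sqrt τ ^ 2 = τ := Real.sq_sqrt hτ0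
  have hsqN : (N ^ (ε / 2)) ^ 2 = N ^ ε := by
    rw [← Real.rpow_two, ← Real.rpow_mul hN0.le]; ring_nf
  have hsqβ : Real.sqrt nβ2 ^ 2 = nβ2 := Real.sq_sqrt hnβ0
  have hexp : Real.exp (2 * Real.pi) ^ 2 = Real.exp (4 * Real.pi) := by
    rw [sq, ← Real.exp_add]; ring_nf
  have h0 : 0 ≤ 4 * Real.exp (4 * Real.pi) * C ^ 2 * τ * N ^ ε * (1 + |X| / (M * N)) * nβ2 := by
    positivity
  calc (2 * Real.exp (2 * Real.pi) * Ka * (1 + |X| / (M * N)) ^ (1 / 2 : ℝ) *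
        (Real.sqrt M + N) * Real.sqrt nβ2) ^ 2
      = 4 * Real.exp (4 * Real.pi) * C ^ 2 * τ * N ^ ε * (1 + |X| / (M * N)) * nβ2 *
          (Real.sqrt M + N) ^ 2 := by
        rw [hKa, mul_pow, mul_pow, mul_pow, mul_pow, mul_pow, mul_pow, mul_pow, hsqW, hsqτ, hsqN,
          hsqβ, hexp]
        ring
    _ ≤ 4 * Real.exp (4 * Real.pi) * C ^ 2 * τ * N ^ ε * (1 + |X| / (M * N)) * nβ2 *
          (2 * (M + N ^ 2)) := mul_le_mul_of_nonneg_left hP h0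
    _ = _ := by ring

/-- **The Weil range for the twisted trilinear second moment** (Bettin–Chandee §6: "if
`M ≫ N²` then one can obtain a stronger bound from Theorem 5 of [DFI97], which gives
`𝓒₁ ≪ ‖β‖²‖ν‖² A M^{1+ε}` in such range"): for every `ε > 0` there is `K` with, for
`M, N, A ≥ 1/2`, `ϑ ≠ 0`, real `η`, `β` on `(N,2N]` and any `ν`,
`∑_{M<m≤2M} |∑_a∑_{n,(m,n)=1} β_n ν_a e(ϑa m̄/n + ηa/(mn))|² ≤ K ‖β‖²‖ν‖² ((1+|ϑ|+|η|)AMN)^ε (1 + (|ϑ|+|η|)A/(MN)) A (M + N²)`.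
Proof: Cauchy–Schwarz in `a`, and `BC_twisted_second_moment_weil` for each `a` (numerator `ϑa`,
twist `ηa`), with `τ(|ϑa|) ≤ C²|ϑa|^{ε/2}`, `|ϑ|a ≤ 8E`, `N ≤ 4E`, `E = (1+|ϑ|+|η|)AMN`.
[cite: BettinChandee2018, §6] [cite: DukeFriedlanderIwaniec1997, Theorem 5] -/
theorem BC_C1Atw_weil_range {ε : ℝ} (hε : 0 < ε) :
    ∃ K : ℝ, 0 < K ∧ ∀ (M N A : ℝ), 1 / 2 ≤ M → 1 / 2 ≤ N → 1 / 2 ≤ A → ∀ (ϑ : ℤ), ϑ ≠ 0 →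
      ∀ (η : ℝ) (β ν : ℕ → ℂ),
      (∀ n : ℕ, β n ≠ 0 → N < n ∧ (n : ℝ) ≤ 2 * N) →
      ∑ m ∈ Ioc ⌊M⌋₊ ⌊2 * M⌋₊, ‖∑ a ∈ Icc 1 ⌊2 * A⌋₊, ∑ n ∈ Icc 1 ⌊2 * N⌋₊,
          (if m.Coprime n then
            β n * ν a * Complex.exp (2 * Real.pi * Complex.I *
              ((ϑ : ℂ) * (a : ℂ) * ((((m : ZMod n)⁻¹).val : ℕ) : ℂ) / (n : ℂ) +
                (η : ℂ) * (a : ℂ) / ((m : ℂ) * (n : ℂ))))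
          else 0)‖ ^ 2 ≤
        K * (∑ n ∈ Icc 1 ⌊2 * N⌋₊, ‖β n‖ ^ 2) * (∑ a ∈ Icc 1 ⌊2 * A⌋₊, ‖ν a‖ ^ 2) *
          ((1 + |(ϑ : ℝ)| + |η|) * (A * M * N)) ^ ε *
          (1 + (|(ϑ : ℝ)| + |η|) * A / (M * N)) * (A * (M + N ^ 2)) := by
  obtain ⟨K₁, hK₁0, hK₁⟩ := BC_twisted_second_moment_weil (ε := ε / 2) (by positivity)
  obtain ⟨C₂, hC₂0, hτ⟩ := DFI_sqrt_tau_le (η := ε / 4) (by positivity)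
  refine ⟨4 * K₁ * C₂ ^ 2 * (32 : ℝ) ^ (ε / 2), by positivity, ?_⟩
  intro M N A hM hN hA ϑ hϑ η β ν hβ
  have hM0 : 0 < M := by linarith
  have hN0 : 0 < N := by linarith
  have hA0 : 0 < A := by linarith
  set SA := Icc 1 ⌊2 * A⌋₊ with hSA
  set SN := Icc 1 ⌊2 * N⌋₊ with hSN
  set nβ2 : ℝ := ∑ n ∈ SN, ‖β n‖ ^ 2 with hnβ2
  set nν2 : ℝ := ∑ a ∈ SA, ‖ν a‖ ^ 2 with hnν2
  have hnβ0 : 0 ≤ nβ2 := Finset.sum_nonneg fun _ _ => sq_nonneg _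
  have hnν0 : 0 ≤ nν2 := Finset.sum_nonneg fun _ _ => sq_nonneg _
  set E : ℝ := (1 + |(ϑ : ℝ)| + |η|) * (A * M * N) with hE
  set W : ℝ := 1 + (|(ϑ : ℝ)| + |η|) * A / (M * N) with hW
  have hE0 : 0 < E := by positivity
  have hWnn : 0 ≤ (|(ϑ : ℝ)| + |η|) * A / (M * N) := by positivity
  -- the inner bilinear sums `S a m = ∑_{(m,n)=1} β_n e(ϑa m̄/n + ηa/(mn))`
  set S : ℕ → ℕ → ℂ := fun a m => ∑ n ∈ SN,
    (if m.Coprime n then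
      β n * Complex.exp (2 * Real.pi * Complex.I *
        ((ϑ : ℂ) * (a : ℂ) * ((((m : ZMod n)⁻¹).val : ℕ) : ℂ) / (n : ℂ) +
          (η : ℂ) * (a : ℂ) / ((m : ℂ) * (n : ℂ))))
    else 0) with hS
  -- the common bound `R` for `∑_m |S a m|²`, `1 ≤ a ≤ 2A`
  set R : ℝ := K₁ * C₂ ^ 2 * (32 : ℝ) ^ (ε / 2) * E ^ ε * (2 * W) * (M + N ^ 2) * nβ2 with hR
  have hR0 : 0 ≤ R := by
    have : 0 ≤ W := by rw [hW]; linarith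
    positivity
  have hTa : ∀ a ∈ SA, ∑ m ∈ Ioc ⌊M⌋₊ ⌊2 * M⌋₊, ‖S a m‖ ^ 2 ≤ R := by
    intro a ha
    have ha1 : 1 ≤ a := (Finset.mem_Icc.mp ha).1
    have ha2A : (a : ℝ) ≤ 2 * A :=
      le_trans (by exact_mod_cast (Finset.mem_Icc.mp ha).2) (Nat.floor_le (by positivity))
    have hk : ϑ * a ≠ 0 := mul_ne_zero hϑ (by exact_mod_cast (show a ≠ 0 by omega))
    have h := hK₁ M N hM hN (ϑ * a) hk (η * a) β hβ
    have heq : ∀ m : ℕ, S a m = ∑ n ∈ Icc 1 ⌊2 * N⌋₊,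
        (if m.Coprime n then
          β n * Complex.exp (2 * Real.pi * Complex.I *
            (((ϑ * a : ℤ) : ℂ) * ((((m : ZMod n)⁻¹).val : ℕ) : ℂ) / (n : ℂ) +
              ((η * a : ℝ) : ℂ) / ((m : ℂ) * n)))
        else 0) := by
      intro m
      rw [hS]; dsimp only
      refine Finset.sum_congr rfl fun n _ => ?_
      split_ifs
      · rw [BC_triPhase_eq_DFI]
      · rfl
    simp_rw [heq]
    refine h.trans ?_
    -- `τ(|ϑa|) ≤ C₂² (8E)^{ε/2}`, `N^{ε/2} ≤ (4E)^{ε/2}`, `1 + |ηa|/(MN) ≤ 2W`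
    have hτa : ((ϑ * a).natAbs.divisors.card : ℝ) ≤ C₂ ^ 2 * (8 * E) ^ (ε / 2) := by
      have h1 := hτ (ϑ * a) hk
      have hle : |((ϑ * a : ℤ) : ℝ)| ≤ 8 * E := by
        push_cast
        rw [abs_mul, Nat.abs_cast]
        have h3 : |(ϑ : ℝ)| ≤ 1 + |(ϑ : ℝ)| + |η| := by linarith [abs_nonneg η]
        have h2 : (a : ℝ) ≤ 8 * (A * M * N) := by
          have hMN : (1 / 2 : ℝ) * (1 / 2) ≤ M * N := mul_le_mul hM hN (by norm_num) hM0.le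
          nlinarith [mul_nonneg hA0.le (show (0 : ℝ) ≤ 4 * (M * N) - 1 by linarith)]
        calc |(ϑ : ℝ)| * a ≤ (1 + |(ϑ : ℝ)| + |η|) * (8 * (A * M * N)) := by gcongr
          _ = 8 * E := by rw [hE]; ring
      have h2 : Real.sqrt ((ϑ * a).natAbs.divisors.card : ℝ) ≤ C₂ * (8 * E) ^ (ε / 4) := by
        refine h1.trans ?_; gcongr
      have h3 : 0 ≤ Real.sqrt ((ϑ * a).natAbs.divisors.card : ℝ) := Real.sqrt_nonneg _
      calc ((ϑ * a).natAbs.divisors.card : ℝ)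
          = Real.sqrt ((ϑ * a).natAbs.divisors.card : ℝ) ^ 2 := (Real.sq_sqrt (Nat.cast_nonneg _)).symm
        _ ≤ (C₂ * (8 * E) ^ (ε / 4)) ^ 2 := pow_le_pow_left₀ h3 h2 2
        _ = C₂ ^ 2 * (8 * E) ^ (ε / 2) := by
            rw [mul_pow, ← Real.rpow_two ((8 * E) ^ (ε / 4)), ← Real.rpow_mul (by positivity)]
            ring_nf
    have hNE : N ^ (ε / 2) ≤ (4 * E) ^ (ε / 2) := by
      refine Real.rpow_le_rpow hN0.le ?_ (by positivity)
      have h1 : (1 : ℝ) ≤ 1 + |(ϑ : ℝ)| + |η| := by linarith [abs_nonneg (ϑ : ℝ), abs_nonneg η]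
      calc N = 1 * (4 * ((1 / 2) * (1 / 2) * N)) := by ring
        _ ≤ (1 + |(ϑ : ℝ)| + |η|) * (4 * (A * M * N)) := by gcongr
        _ = 4 * E := by rw [hE]; ring
    have hX : 1 + |η * a| / (M * N) ≤ 2 * W := by
      rw [hW, abs_mul, Nat.abs_cast]
      have h1 : |η| * a / (M * N) ≤ (|(ϑ : ℝ)| + |η|) * A / (M * N) * 2 := by
        rw [div_mul_eq_mul_div]
        refine div_le_div_of_nonneg_right ?_ (by positivity)
        have h3 : |η| * a ≤ |η| * (2 * A) := mul_le_mul_of_nonneg_left ha2A (abs_nonneg η)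
        have h4 : 0 ≤ |(ϑ : ℝ)| * A := by positivity
        linarith
      linarith
    have h8 : (8 * E) ^ (ε / 2) = (8 : ℝ) ^ (ε / 2) * E ^ (ε / 2) :=
      Real.mul_rpow (by norm_num) hE0.le
    have h4 : (4 * E) ^ (ε / 2) = (4 : ℝ) ^ (ε / 2) * E ^ (ε / 2) :=
      Real.mul_rpow (by norm_num) hE0.le
    have h32 : (32 : ℝ) ^ (ε / 2) = (8 : ℝ) ^ (ε / 2) * (4 : ℝ) ^ (ε / 2) := by
      rw [show (32 : ℝ) = 8 * 4 by norm_num]; exact Real.mul_rpow (by norm_num) (by norm_num)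
    have hE2 : E ^ (ε / 2) * E ^ (ε / 2) = E ^ ε := by
      rw [← Real.rpow_add hE0]; ring_nf
    have hW2 : 0 ≤ 2 * W := by rw [hW]; linarith
    calc K₁ * ((ϑ * a).natAbs.divisors.card : ℝ) * N ^ (ε / 2) * (1 + |η * ↑a| / (M * N)) *
          (M + N ^ 2) * nβ2
        ≤ K₁ * (C₂ ^ 2 * (8 * E) ^ (ε / 2)) * (4 * E) ^ (ε / 2) * (2 * W) * (M + N ^ 2) * nβ2 := by
          gcongr
      _ = R := by rw [hR, h8, h4, h32, ← hE2]; ring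
  -- Cauchy–Schwarz in `a`, then sum the bounds `hTa`
  have hCSa : ∀ m : ℕ, ‖∑ a ∈ SA, ∑ n ∈ SN,
      (if m.Coprime n then
        β n * ν a * Complex.exp (2 * Real.pi * Complex.I *
          ((ϑ : ℂ) * (a : ℂ) * ((((m : ZMod n)⁻¹).val : ℕ) : ℂ) / (n : ℂ) +
            (η : ℂ) * (a : ℂ) / ((m : ℂ) * (n : ℂ))))
      else 0)‖ ^ 2 ≤ nν2 * ∑ a ∈ SA, ‖S a m‖ ^ 2 := by
    intro m
    have heq : ∑ a ∈ SA, ∑ n ∈ SN,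
        (if m.Coprime n then
          β n * ν a * Complex.exp (2 * Real.pi * Complex.I *
            ((ϑ : ℂ) * (a : ℂ) * ((((m : ZMod n)⁻¹).val : ℕ) : ℂ) / (n : ℂ) +
              (η : ℂ) * (a : ℂ) / ((m : ℂ) * (n : ℂ))))
        else 0) = ∑ a ∈ SA, ν a * S a m := by
      refine Finset.sum_congr rfl fun a _ => ?_
      rw [hS]; dsimp only
      rw [Finset.mul_sum]
      refine Finset.sum_congr rfl fun n _ => ?_
      split_ifs
      · ring
      · rw [mul_zero]
    rw [heq]
    have h := DFI_norm_sum_mul_le_sqrt_mul_sqrt SA ν (fun a => S a m)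
    have h0 : 0 ≤ ∑ a ∈ SA, ‖S a m‖ ^ 2 := Finset.sum_nonneg fun _ _ => sq_nonneg _
    calc ‖∑ a ∈ SA, ν a * S a m‖ ^ 2
        ≤ (Real.sqrt nν2 * Real.sqrt (∑ a ∈ SA, ‖S a m‖ ^ 2)) ^ 2 :=
          pow_le_pow_left₀ (norm_nonneg _) h 2
      _ = nν2 * ∑ a ∈ SA, ‖S a m‖ ^ 2 := by
          rw [mul_pow, Real.sq_sqrt hnν0, Real.sq_sqrt h0]
  have hcardA : (SA.card : ℝ) ≤ 2 * A := by
    rw [hSA, Nat.card_Icc]; simpa using Nat.floor_le (by positivity : (0 : ℝ) ≤ 2 * A)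
  calc ∑ m ∈ Ioc ⌊M⌋₊ ⌊2 * M⌋₊, ‖∑ a ∈ SA, ∑ n ∈ SN,
        (if m.Coprime n then
          β n * ν a * Complex.exp (2 * Real.pi * Complex.I *
            ((ϑ : ℂ) * (a : ℂ) * ((((m : ZMod n)⁻¹).val : ℕ) : ℂ) / (n : ℂ) +
              (η : ℂ) * (a : ℂ) / ((m : ℂ) * (n : ℂ))))
        else 0)‖ ^ 2
      ≤ ∑ m ∈ Ioc ⌊M⌋₊ ⌊2 * M⌋₊, nν2 * ∑ a ∈ SA, ‖S a m‖ ^ 2 :=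
        Finset.sum_le_sum fun m _ => hCSa m
    _ = nν2 * ∑ a ∈ SA, ∑ m ∈ Ioc ⌊M⌋₊ ⌊2 * M⌋₊, ‖S a m‖ ^ 2 := by
        rw [← Finset.mul_sum, Finset.sum_comm]
    _ ≤ nν2 * ∑ a ∈ SA, R := by
        refine mul_le_mul_of_nonneg_left (Finset.sum_le_sum fun a ha => hTa a ha) hnν0
    _ = nν2 * (SA.card * R) := by rw [Finset.sum_const, nsmul_eq_mul]
    _ ≤ nν2 * (2 * A * R) :=
        mul_le_mul_of_nonneg_left (mul_le_mul_of_nonneg_right hcardA hR0) hnν0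
    _ = _ := by rw [hR]; ring

end Literature.NumberTheory.LFunctions

end
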